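import Mathlib
import HarnessLib
import Literature.MathematicalPhysics.QuantumLattice.HubbardGrandCanonicalDensity
import Literature.MathematicalPhysics.QuantumLattice.KohnLuttinger

/-!
# Crux `CwChiralConstruction` (stmt-HubbardSuperconductivity-1740), line `susceptibility-rise-budget`:
# stub `stub_densityOfLimits`

Griffiths' lemma + monotonicity + slope stability. Granted the two neighbour limits as LITERAL
hypotheses — `(TL)`: the grand-canonical ground-state energy density
`E₀(hubbardTorusWith 2 (L+1) 1 U μ)/(L+1)²` has a limit `e(U, μ)` for all `U, μ`; `(FREE)`: at
`U = 0` the limit is a function `e₀` with `e₀' = -F`, where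
`F = KohnLuttinger.filling (squareDispersion 1 0)` is continuous, `F = 0` on `(-∞, -4]` and `F = 2`
on `(4, ∞)` — we prove the density clause `(D)`: for every `η > 0` there is `U₁ > 0` such that for
`U ∈ (0, U₁)` and every window `[μ₁, μ₂]` on which `F ∈ [13/25 + η, 7/10 - η]`, some
`μ ∈ (μ₁, μ₂)` and `δ ∈ [3/10, 12/25]` have tracial ground-state density
`Re ω_{L+1, μ}(N)/(L+1)² → 1 - δ`.

Proof (helpers in namespace `CwDensity`; everything model-specific is the tree file
`HubbardGrandCanonicalDensity`): `e(U, ·)` is non-increasing (limit of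
`groundEnergy_torus_sub_mem_Icc_of_le`), hence differentiable Lebesgue-a.e. (Lebesgue,
`Monotone.ae_differentiableAt`), so some `μ ∈ (μ₁, μ₂)` is a differentiability point; there
Griffiths' lemma (`tendsto_gcDensity_of_hasDerivAt`) gives the density limit `-∂_μ e(U, μ)`, and
the finite-volume Griffiths sandwich (`gcNumber_torus_mem_Icc_slope`) passes to the limit as the
chord sandwich `(e(μ-Δ) - e(μ))/Δ ≤ -∂_μ e ≤ (e(μ) - e(μ+Δ))/Δ`. Since `e₀ ≤ e(U, ·) ≤ e₀ + U`
(`groundEnergy_torus_sub_free_mem_Icc`) and `(e₀ b - e₀ a)/(b - a) = -F(ξ)` (mean value theorem),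
`-∂_μ e ∈ [F(ξ) - U/Δ, F(ξ') + U/Δ]` with `|ξ - μ|, |ξ' - μ| < Δ`; the window forces `-4 < μ₁`,
`μ₂ ≤ 4`, so uniform continuity of `F` on `[-5, 5]` (modulus `Δ = Δ(η) ≤ 1/2` for oscillation
`< η/2`) and `U < U₁ = ηΔ/2` put `-∂_μ e ∈ [13/25, 7/10]`. Folklore (R. B. Griffiths, J. Math.
Phys. 5 (1964) 1215; D. Ruelle, *Statistical Mechanics: Rigorous Results* (1969)); no definitions,
no named facts.
-/

set_option linter.dupNamespace false -- the summit namespace repeats `HubbardSuperconductivity`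

namespace Summit.HubbardSuperconductivity.HubbardSuperconductivity.Theorems

open Literature.MathematicalPhysics.QuantumLattice Literature.Probability.LatticeModels Matrix Filter
open scoped Matrix.Norms.L2Operator ComplexOrder Topology

namespace CwDensity

/-! ### Limits of the finite-volume bounds -/

/-- **The limiting energy density is non-increasing in `μ`**: if
`E₀(hubbardTorusWith 2 (L+1) 1 U μ)/(L+1)² → f μ` for every `μ`, then `f` is antitone (limit of the
finite-volume monotonicity `E₀(μ') ≤ E₀(μ)` for `μ ≤ μ'`, tree
`groundEnergy_torus_sub_mem_Icc_of_le`). [folklore] -/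
theorem antitone_of_tendsto {U : ℝ} {f : ℝ → ℝ}
    (hf : ∀ μ : ℝ, Tendsto (fun L : ℕ => (hubbardTorusWith 2 (L + 1) 1 U μ).groundEnergy /
      ((L + 1 : ℕ) : ℝ) ^ 2) atTop (𝓝 (f μ))) :
    Antitone f := by
  intro a b hab
  refine le_of_tendsto_of_tendsto' (hf b) (hf a) fun L => ?_
  have h := (groundEnergy_torus_sub_mem_Icc_of_le (L + 1) 1 U hab).1
  exact div_le_div_of_nonneg_right (sub_nonneg.1 h) (by positivity)

/-- **The interacting and free limiting energy densities differ by at most `U`**: if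
`E₀(L+1, U, μ)/(L+1)² → a` and `E₀(L+1, 0, μ)/(L+1)² → b` with `U ≥ 0`, then `b ≤ a ≤ b + U`
(limit of the tree's interaction sandwich `groundEnergy_torus_sub_free_mem_Icc`). [folklore] -/
theorem free_sandwich_of_tendsto {U μ a b : ℝ} (hU : 0 ≤ U)
    (ha : Tendsto (fun L : ℕ => (hubbardTorusWith 2 (L + 1) 1 U μ).groundEnergy /
      ((L + 1 : ℕ) : ℝ) ^ 2) atTop (𝓝 a))
    (hb : Tendsto (fun L : ℕ => (hubbardTorusWith 2 (L + 1) 1 0 μ).groundEnergy /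
      ((L + 1 : ℕ) : ℝ) ^ 2) atTop (𝓝 b)) :
    b ≤ a ∧ a ≤ b + U := by
  constructor
  · refine le_of_tendsto_of_tendsto' hb ha fun L => ?_
    have h := (groundEnergy_torus_sub_free_mem_Icc (L + 1) 1 μ hU).1
    exact div_le_div_of_nonneg_right (sub_nonneg.1 h) (by positivity)
  · refine le_of_tendsto_of_tendsto' ha (hb.add_const U) fun L => ?_
    have h := (groundEnergy_torus_sub_free_mem_Icc (L + 1) 1 μ hU).2
    have hN : (0 : ℝ) < ((L + 1 : ℕ) : ℝ) ^ 2 := by positivity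
    rw [← sub_le_iff_le_add', ← sub_div, div_le_iff₀ hN]
    exact h

/-- **A differentiability point in every nondegenerate interval**: a non-increasing real function
is differentiable Lebesgue-almost everywhere (Lebesgue's differentiation theorem,
`Monotone.ae_differentiableAt`), and a Lebesgue-null set cannot contain `(a, b)` for `a < b`.
[folklore] -/
theorem exists_differentiableAt {f : ℝ → ℝ} (hf : Antitone f) {a b : ℝ} (hab : a < b) :
    ∃ x ∈ Set.Ioo a b, DifferentiableAt ℝ f x := by
  have hae : ∀ᵐ x, DifferentiableAt ℝ f x := by
    filter_upwards [hf.neg.ae_differentiableAt] with x hx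
    exact differentiableAt_fun_neg_iff.1 hx
  by_contra hcon
  push Not at hcon
  have h0 : MeasureTheory.volume {x | ¬DifferentiableAt ℝ f x} = 0 := MeasureTheory.ae_iff.1 hae
  have hsub : Set.Ioo a b ⊆ {x | ¬DifferentiableAt ℝ f x} := fun x hx => hcon x hx
  have h := MeasureTheory.measure_mono_null hsub h0
  rw [Real.volume_Ioo, ENNReal.ofReal_eq_zero] at h
  linarith

/-- **The chord sandwich in the limit.** At a differentiability point `μ` of the limiting energy
density `f = e(U, ·)` (`HasDerivAt f D μ`), for every `ε > 0`,
`(f(μ-ε) - f(μ))/ε ≤ -D ≤ (f(μ) - f(μ+ε))/ε`: the finite-volume Griffiths sandwich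
(`gcNumber_torus_mem_Icc_slope`) divided by `(L+1)²`, in the limit `L → ∞`, the density converging
to `-D` by Griffiths' lemma (`tendsto_gcDensity_of_hasDerivAt`). [folklore] -/
theorem slope_sandwich {U μ D ε : ℝ} {f : ℝ → ℝ} (hε : 0 < ε)
    (hf : ∀ μ' : ℝ, Tendsto (fun L : ℕ => (hubbardTorusWith 2 (L + 1) 1 U μ').groundEnergy /
      ((L + 1 : ℕ) : ℝ) ^ 2) atTop (𝓝 (f μ')))
    (hD : HasDerivAt f D μ) :
    (f (μ - ε) - f μ) / ε ≤ -D ∧ -D ≤ (f μ - f (μ + ε)) / ε := by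
  have hdens := tendsto_gcDensity_of_hasDerivAt 1 U μ (e := f) (Eventually.of_forall hf) hD
  constructor
  · refine le_of_tendsto_of_tendsto' (((hf (μ - ε)).sub (hf μ)).div_const ε) hdens fun L => ?_
    have h := (gcNumber_torus_mem_Icc_slope (L + 1) 1 U μ hε).1
    have hN : (0 : ℝ) < ((L + 1 : ℕ) : ℝ) ^ 2 := by positivity
    rw [← sub_div, div_right_comm]
    exact div_le_div_of_nonneg_right h hN.le
  · refine le_of_tendsto_of_tendsto' hdens (((hf μ).sub (hf (μ + ε))).div_const ε) fun L => ?_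
    have h := (gcNumber_torus_mem_Icc_slope (L + 1) 1 U μ hε).2
    have hN : (0 : ℝ) < ((L + 1 : ℕ) : ℝ) ^ 2 := by positivity
    rw [← sub_div, div_right_comm]
    exact div_le_div_of_nonneg_right h hN.le

/-! ### Two pieces of real analysis -/

/-- **The mean value theorem for the free energy density**: granted `e₀' = -F` everywhere, for
`a < b` some `ξ ∈ (a, b)` has `-F(ξ) = (e₀ b - e₀ a)/(b - a)`. [folklore] -/
theorem exists_slope_eq {e₀ F : ℝ → ℝ} (hder : ∀ μ : ℝ, HasDerivAt e₀ (-F μ) μ) {a b : ℝ}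
    (hab : a < b) : ∃ ξ ∈ Set.Ioo a b, -F ξ = (e₀ b - e₀ a) / (b - a) :=
  exists_hasDerivAt_eq_slope e₀ (fun x => -F x) hab
    (fun x _ => (hder x).continuousAt.continuousWithinAt) fun x _ => hder x

/-- **A uniform modulus on `[-5, 5]`**: a continuous `F : ℝ → ℝ` is uniformly continuous on the
compact `[-5, 5]` (Heine–Cantor), so for `ε > 0` there is `Δ ∈ (0, 1/2]` with `|F x - F y| < ε`
whenever `x, y ∈ [-5, 5]`, `|x - y| < Δ`. [folklore] -/
theorem exists_modulus {F : ℝ → ℝ} (hF : Continuous F) {ε : ℝ} (hε : 0 < ε) :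
    ∃ Δ : ℝ, 0 < Δ ∧ Δ ≤ 1 / 2 ∧ ∀ x ∈ Set.Icc (-5 : ℝ) 5, ∀ y ∈ Set.Icc (-5 : ℝ) 5,
      |x - y| < Δ → |F x - F y| < ε := by
  obtain ⟨δ, hδ, h⟩ := Metric.uniformContinuousOn_iff.1
    (isCompact_Icc.uniformContinuousOn_of_continuous hF.continuousOn) ε hε
  refine ⟨min δ 1 / 2, by positivity, ?_, fun x hx y hy hxy => ?_⟩
  · have := min_le_right δ 1
    linarith
  · have hxy' : dist x y < δ := by
      rw [Real.dist_eq]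
      have := min_le_left δ 1
      linarith
    have := h x hx y hy hxy'
    rwa [Real.dist_eq] at this

end CwDensity

/-- **Stub `stub_densityOfLimits`** of the lead's skeleton (crux `CwChiralConstruction`, line
`susceptibility-rise-budget`): Griffiths + monotonicity + slope stability. Granted the two limits
`(TL)` (a thermodynamic limit `e(U, μ)` of the grand-canonical ground-state energy density of
`hubbardTorusWith 2 (L+1) 1 U μ` for all `U, μ`) and `(FREE)` (the free limit `e₀` with
`e₀' = -filling`, the filling continuous, `= 0` below `-4`, `= 2` above `4`): `e(U, ·)` is
non-increasing, within `U` of `e₀`, differentiable off a Lebesgue-null set; at a differentiability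
point `μ ∈ (μ₁, μ₂)` Griffiths' lemma (tree `tendsto_gcDensity_of_hasDerivAt`) gives the density
limit `-∂_μ e(U, μ)`, and the chord sandwich against the mean value theorem for `e₀` plus uniform
continuity of the filling on `[-5, 5] ⊇` every admissible window put `-∂_μ e(U, μ) ∈ [13/25, 7/10]`
for `U < U₁(η)`. [folklore: Griffiths 1964; Ruelle 1969] -/
theorem stub_densityOfLimits :
    (∀ U μ : ℝ, ∃ e : ℝ, Tendsto (fun L : ℕ => (hubbardTorusWith 2 (L + 1) 1 U μ).groundEnergy / ((L + 1 : ℕ) : ℝ) ^ 2) atTop (𝓝 e)) →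
    (∃ e₀ : ℝ → ℝ, (∀ μ : ℝ, Tendsto (fun L : ℕ => (hubbardTorusWith 2 (L + 1) 1 0 μ).groundEnergy / ((L + 1 : ℕ) : ℝ) ^ 2) atTop (𝓝 (e₀ μ))) ∧ (∀ μ : ℝ, HasDerivAt e₀ (-KohnLuttinger.filling (squareDispersion 1 0) μ) μ) ∧ Continuous (fun μ : ℝ => KohnLuttinger.filling (squareDispersion 1 0) μ) ∧ (∀ μ : ℝ, μ ≤ -4 → KohnLuttinger.filling (squareDispersion 1 0) μ = 0) ∧ (∀ μ : ℝ, 4 < μ → KohnLuttinger.filling (squareDispersion 1 0) μ = 2)) →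
    ∀ η : ℝ, 0 < η → ∃ U₁ : ℝ, 0 < U₁ ∧ ∀ U ∈ Set.Ioo (0 : ℝ) U₁, ∀ μ₁ μ₂ : ℝ, μ₁ < μ₂ → (∀ μ ∈ Set.Icc μ₁ μ₂, KohnLuttinger.filling (squareDispersion 1 0) μ ∈ Set.Icc (13 / 25 + η) (7 / 10 - η)) → ∃ μ ∈ Set.Ioo μ₁ μ₂, ∃ δ ∈ Set.Icc (3 / 10 : ℝ) (12 / 25), Tendsto (fun L : ℕ => ((hubbardTorusWith 2 (L + 1) 1 U μ).groundStateFunctional totalNumber).re / ((L + 1 : ℕ) : ℝ) ^ 2) atTop (𝓝 (1 - δ)) := by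
  intro hTL hFREE η hη
  choose e he using hTL
  obtain ⟨e₀, he₀, hder, hFc, hF0, hF2⟩ := hFREE
  -- a uniform modulus `Δ ≤ 1/2` of the filling on `[-5, 5]` for the oscillation `η/2`
  obtain ⟨Δ, hΔ, hΔ1, hUC⟩ :=
    CwDensity.exists_modulus (F := KohnLuttinger.filling (squareDispersion 1 0)) hFc (half_pos hη)
  refine ⟨η * Δ / 2, by positivity, ?_⟩
  rintro U ⟨hU0, hU1⟩ μ₁ μ₂ h12 hwin
  -- the window lies in `(-4, 4]`
  have hμ₁ : -4 < μ₁ := by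
    by_contra h
    have h1 := (hwin μ₁ (Set.left_mem_Icc.2 h12.le)).1
    rw [hF0 μ₁ (not_lt.1 h)] at h1
    linarith
  have hμ₂ : μ₂ ≤ 4 := by
    by_contra h
    have h1 := (hwin μ₂ (Set.right_mem_Icc.2 h12.le)).2
    rw [hF2 μ₂ (not_le.1 h)] at h1
    linarith
  -- a differentiability point of the non-increasing limit `e U`
  obtain ⟨μ, hμ, hdiff⟩ :=
    CwDensity.exists_differentiableAt (CwDensity.antitone_of_tendsto (he U)) h12
  have hD : HasDerivAt (e U) (deriv (e U) μ) μ := hdiff.hasDerivAt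
  set D := deriv (e U) μ with hDdef
  refine ⟨μ, hμ, 1 + D, ?_, ?_⟩
  · -- slope stability: `-D ∈ [13/25, 7/10]`
    obtain ⟨hlo, hhi⟩ := CwDensity.slope_sandwich hΔ (he U) hD
    obtain ⟨-, b0⟩ := CwDensity.free_sandwich_of_tendsto hU0.le (he U μ) (he₀ μ)
    obtain ⟨bm, -⟩ := CwDensity.free_sandwich_of_tendsto hU0.le (he U (μ - Δ)) (he₀ (μ - Δ))
    obtain ⟨bp, -⟩ := CwDensity.free_sandwich_of_tendsto hU0.le (he U (μ + Δ)) (he₀ (μ + Δ))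
    obtain ⟨ξ, hξ, hξeq⟩ := CwDensity.exists_slope_eq hder (show μ - Δ < μ by linarith)
    obtain ⟨ξ', hξ', hξ'eq⟩ := CwDensity.exists_slope_eq hder (show μ < μ + Δ by linarith)
    rw [show μ - (μ - Δ) = Δ by ring] at hξeq
    rw [show μ + Δ - μ = Δ by ring] at hξ'eq
    have hFμ := hwin μ ⟨hμ.1.le, hμ.2.le⟩
    have hμI : μ ∈ Set.Icc (-5 : ℝ) 5 := ⟨by linarith [hμ.1], by linarith [hμ.2]⟩
    have hξI : ξ ∈ Set.Icc (-5 : ℝ) 5 := ⟨by linarith [hξ.1, hμ.1], by linarith [hξ.2, hμ.2]⟩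
    have hξ'I : ξ' ∈ Set.Icc (-5 : ℝ) 5 :=
      ⟨by linarith [hξ'.1, hμ.1], by linarith [hξ'.2, hμ.2]⟩
    have h1 := hUC ξ hξI μ hμI
      (by rw [abs_sub_lt_iff]; constructor <;> linarith [hξ.1, hξ.2])
    have h2 := hUC ξ' hξ'I μ hμI
      (by rw [abs_sub_lt_iff]; constructor <;> linarith [hξ'.1, hξ'.2])
    rw [abs_sub_lt_iff] at h1 h2
    have hUΔ : U / Δ < η / 2 := by
      rw [div_lt_iff₀ hΔ]
      linarith
    -- upper chord: `-D ≤ (e μ - e (μ+Δ))/Δ ≤ U/Δ + F ξ'`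
    have hX : (e U μ - e U (μ + Δ)) / Δ ≤
        U / Δ + KohnLuttinger.filling (squareDispersion 1 0) ξ' := by
      have hm : -KohnLuttinger.filling (squareDispersion 1 0) ξ' * Δ = e₀ (μ + Δ) - e₀ μ := by
        rw [hξ'eq, div_mul_cancel₀ _ hΔ.ne']
      rw [neg_mul] at hm
      have h3 : e U μ - e U (μ + Δ) ≤
          U + KohnLuttinger.filling (squareDispersion 1 0) ξ' * Δ := by
        linarith
      calc (e U μ - e U (μ + Δ)) / Δ
          ≤ (U + KohnLuttinger.filling (squareDispersion 1 0) ξ' * Δ) / Δ :=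
            div_le_div_of_nonneg_right h3 hΔ.le
        _ = U / Δ + KohnLuttinger.filling (squareDispersion 1 0) ξ' := by
            rw [add_div, mul_div_cancel_right₀ _ hΔ.ne']
    -- lower chord: `F ξ - U/Δ ≤ (e (μ-Δ) - e μ)/Δ ≤ -D`
    have hY : KohnLuttinger.filling (squareDispersion 1 0) ξ - U / Δ ≤
        (e U (μ - Δ) - e U μ) / Δ := by
      have hm : -KohnLuttinger.filling (squareDispersion 1 0) ξ * Δ = e₀ μ - e₀ (μ - Δ) := by
        rw [hξeq, div_mul_cancel₀ _ hΔ.ne']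
      rw [neg_mul] at hm
      have h3 : KohnLuttinger.filling (squareDispersion 1 0) ξ * Δ - U ≤
          e U (μ - Δ) - e U μ := by
        linarith
      calc KohnLuttinger.filling (squareDispersion 1 0) ξ - U / Δ
          = (KohnLuttinger.filling (squareDispersion 1 0) ξ * Δ - U) / Δ := by
            rw [sub_div, mul_div_cancel_right₀ _ hΔ.ne']
        _ ≤ (e U (μ - Δ) - e U μ) / Δ := div_le_div_of_nonneg_right h3 hΔ.le
    constructor
    · linarith [hFμ.2, h2.1, h2.2]
    · linarith [hFμ.1, h1.1, h1.2]
  · -- Griffiths' lemma at the differentiability point `μ`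
    have h := tendsto_gcDensity_of_hasDerivAt 1 U μ (e := e U) (Eventually.of_forall (he U)) hD
    rw [show (1 : ℝ) - (1 + D) = -D by ring]
    exact h

end Summit.HubbardSuperconductivity.HubbardSuperconductivity.Theorems
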